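import Literature.Probability.LatticeModels.IsingEffectiveField
import Literature.Probability.LatticeModels.IsingFieldModel
import Literature.Probability.LatticeModels.LeeYangRadii
import Literature.Probability.LatticeModels.LeeYangLipschitz
import HarnessLib

/-!
# The `+` boundary condition Ising weights as a Lee–Yang polynomial in a common extra activity;
# the Lipschitz bound on `∑_k ⟨σ_k⟩⁺_Λ` from a zero-free disc

Topic `Probability/LatticeModels`, namespace `Literature.Probability.LatticeModels`. For the
finite-volume Ising model `μ⁺_{Λ;β,h}` with a site-dependent field on a locally finite graph
(`IsingFieldModel`: weight `exp(-β ℋ)`, `ℋ⁺_{Λ;h} = -∑_{e ∈ ℰᵇ_Λ} σ_e - ∑_{x∈Λ} h_x σ_x`), the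
boundary bonds act as fields (`IsingEffectiveField.sum_edgeBoundary_bondSpin`): with
`t = e^{-2β}` and `g_x = h_x + #{y ∼ x : y ∉ Λ}`,
`exp(-βℋ⁺(σ)) = e^{β(|ℰ_Λ| + ∑ g)} ∏_{e∈ℰ_Λ} [σ agrees on e ? 1 : t] ∏_{x∈Λ} [σ_x = + ? 1 : e^{-2βg_x}]`
(Lee–Yang 1952; Friedli–Velenik 2017, §3.7.4, first display of the proof of Theorem 3.43). Hence,
shifting the field by a constant `l` on `Λ` multiplies every single-site activity by the common
factor `ω = e^{-2βl}`, and

* `fieldWeight_plus_shift_eq` — the factorisation above, coded on `Λ → Bool` (`plusCfg`,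
  `boolEquiv`), with the edge product written over ORIENTED pairs `orPairs G Λ lower` (one
  orientation `lower` per edge, `prod_edgesIn_eq_prod_orPairs`) so that it is literally the
  weight `LeeYangRadii.edgeWeight` of `LeeYangRadii.zeroFree_prod_edges`;
* `sum_fieldExpect_plus_shift_eq` — `∑_{k∈Λ} ⟨σ_k⟩⁺_{Λ;h+l} = |Λ| - 2⟨#minus⟩_ω`
  (`LeeYangRadii.minusMean` of the edge weight `edgeWeightR` and the base activities `baseAct`);
* `lySum_plus_ne_zero` — the Lee–Yang sum is zero-free as soon as every activity
  `baseAct k · |ω|` is below the radius `LeeYangRadii.radii` certified by an assignment of radii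
  `rad` to the lower ends of the oriented edges (`orTriples`);
* `sum_fieldExpect_plus_sub_shift_le` — **if the Lee–Yang sum has no zero for `‖ω‖ < R`, `R > 1`,
  then for `-δ ≤ l ≤ 0` with `e^{2βδ} ≤ (1+R)/2`:
  `∑_{k∈Λ} ⟨σ_k⟩⁺_{Λ;h} - ∑_{k∈Λ} ⟨σ_k⟩⁺_{Λ;h+l} ≤ |Λ| · 8βR e^{2βδ}/(R-1)² · (-l)`** — the
  hypothesis of `IsingFieldUniquenessLipschitz.exists_volume_plusMag_sub_minusMag_le_of_lipschitz`.

No named facts; everything is proved. Used by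
`Literature/Barriers/CriticalPhenomena/PositionSpaceRGNonGibbsianLeeYang.lean`.

## References

* T. D. Lee, C. N. Yang, Phys. Rev. 87 (1952) 410–419, Appendix II [LeeYang1952].
* S. Friedli, Y. Velenik, *Statistical Mechanics of Lattice Systems* (CUP 2017), §3.7.4 (proof
  of Theorem 3.43, first display), §3.8.1 p. 141 [FriedliVelenik2017].
-/

noncomputable section

open Finset
open scoped BigOperators

namespace Literature.Probability.LatticeModels

variable {V : Type*} (G : SimpleGraph V) [DecidableEq V] [G.LocallyFinite] [DecidableRel G.Adj]
  (Λ : Finset V)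

/-! ### Boolean coding of the configurations in `Λ` with `+` boundary condition -/

/-- The spin configuration with `+` boundary condition coded by `σ : Λ → Bool`
(`true = +1`, `false = -1`). [cite: FriedliVelenik2017, §3.7.4] -/
def plusCfg (σ : Λ → Bool) : SpinConfig V := glue Λ (fun k => if σ k then 1 else -1) .plus

omit [DecidableEq V] [G.LocallyFinite] [DecidableRel G.Adj] in
/-- The Boolean code of a configuration in `Λ`. [cite: FriedliVelenik2017, §3.7.4] -/
def boolOf (τ : Λ → ℤˣ) : Λ → Bool := fun k => decide (τ k = 1)

omit [DecidableEq V] [G.LocallyFinite] [DecidableRel G.Adj] in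
/-- Configurations in `Λ` and their Boolean codes correspond bijectively. [folklore] -/
def boolEquiv : (Λ → ℤˣ) ≃ (Λ → Bool) where
  toFun := boolOf Λ
  invFun σ := fun k => if σ k then 1 else -1
  left_inv τ := by
    funext k
    rcases Int.units_eq_one_or (τ k) with h | h <;> simp [boolOf, h]
  right_inv σ := by
    funext k
    cases hk : σ k <;> simp [boolOf, hk]

omit [DecidableEq V] [G.LocallyFinite] [DecidableRel G.Adj] in
/-- Gluing a configuration with `+` outside is `plusCfg` of its code. [cite: FriedliVelenik2017, §3.1] -/
theorem glue_plus_eq_plusCfg (τ : Λ → ℤˣ) : glue Λ τ .plus = plusCfg Λ (boolOf Λ τ) := by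
  unfold plusCfg
  congr 1
  funext k
  rcases Int.units_eq_one_or (τ k) with h | h <;> simp [boolOf, h]

omit [DecidableEq V] [G.LocallyFinite] [DecidableRel G.Adj] in
/-- The coded spin at a site of `Λ`. [cite: FriedliVelenik2017, §3.1] -/
theorem spinAt_plusCfg (σ : Λ → Bool) (k : Λ) :
    spinAt (k : V) (plusCfg Λ σ) = if σ k then 1 else -1 := by
  unfold plusCfg
  rw [spinAt_glue_coe]
  cases hk : σ k <;> simp [spinAt, hk]

omit [DecidableEq V] [G.LocallyFinite] [DecidableRel G.Adj] in
/-- Outside `Λ` the coded configuration is `+1`. [cite: FriedliVelenik2017, §3.1] -/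
theorem spinAt_plusCfg_of_not_mem (σ : Λ → Bool) {z : V} (hz : z ∉ Λ) :
    spinAt z (plusCfg Λ σ) = 1 := by
  unfold plusCfg
  rw [spinAt_glue_of_not_mem _ _ hz]
  simp [spinAt, BoundaryCondition.plus]

omit [DecidableEq V] [G.LocallyFinite] [DecidableRel G.Adj] in
/-- `∑_{k} [σ_k ? 1 : -1] = |Λ| - 2 #minus(σ)`. [folklore] -/
theorem sum_ite_spin_eq (σ : Λ → Bool) :
    ∑ k : Λ, (if σ k then (1 : ℝ) else -1) = Λ.card - 2 * LeeYangRadii.minusCount σ := by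
  have h : ∀ k : Λ, (if σ k then (1 : ℝ) else -1) = 1 - 2 * (if σ k = false then 1 else 0) := by
    intro k; cases σ k <;> norm_num
  simp_rw [h]
  rw [Finset.sum_sub_distrib, Finset.sum_const, Finset.card_univ, Fintype.card_coe,
    nsmul_eq_mul, mul_one, ← Finset.mul_sum, Finset.sum_boole]
  rfl

omit [DecidableEq V] [G.LocallyFinite] [DecidableRel G.Adj] in
/-- The total spin in `Λ` of a glued configuration. [cite: FriedliVelenik2017, §3.1] -/
theorem sum_spinAt_glue_plus (τ : Λ → ℤˣ) :
    ∑ k ∈ Λ, spinAt k (glue Λ τ .plus) = Λ.card - 2 * LeeYangRadii.minusCount (boolOf Λ τ) := by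
  rw [glue_plus_eq_plusCfg, ← Finset.sum_coe_sort Λ]
  simp_rw [spinAt_plusCfg]
  exact sum_ite_spin_eq Λ _

/-! ### Oriented pairs: one orientation per edge inside `Λ` -/

variable (lower : V → V → Prop) [DecidableRel lower]

omit [DecidableEq V] [G.LocallyFinite] in
/-- The ORIENTED pairs of adjacent sites of `Λ`, lower end first, for an orientation predicate
`lower` selecting exactly one orientation of every edge. [cite: LeeYang1952, Appendix II] -/
def orPairs : Finset (Λ × Λ) :=
  Finset.univ.filter fun p => G.Adj (p.1 : V) p.2 ∧ lower (p.1 : V) p.2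

omit [DecidableEq V] [G.LocallyFinite] in
/-- Membership in `orPairs`. [folklore] -/
@[simp] theorem mem_orPairs {p : Λ × Λ} :
    p ∈ orPairs G Λ lower ↔ G.Adj (p.1 : V) p.2 ∧ lower (p.1 : V) p.2 := by
  simp [orPairs]

omit [DecidableEq V] [G.LocallyFinite] in
/-- The oriented pairs are mapped injectively to edges (an edge has only one lower end).
[folklore] -/
theorem injOn_mk_orPairs (hlower : ∀ x y, G.Adj x y → (lower x y ↔ ¬ lower y x)) :
    ∀ p ∈ orPairs G Λ lower, ∀ q ∈ orPairs G Λ lower,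
      s((p.1 : V), p.2) = s((q.1 : V), q.2) → p = q := by
  intro p hp q hq heq
  rw [mem_orPairs] at hp hq
  rcases Sym2.eq_iff.1 heq with ⟨h1, h2⟩ | ⟨h1, h2⟩
  · exact Prod.ext (Subtype.ext h1) (Subtype.ext h2)
  · exfalso
    have := (hlower _ _ hp.1).1 hp.2
    rw [h1, h2] at this
    exact this hq.2

/-- **Edges inside `Λ` are the oriented pairs**: `ℰ_Λ = {s(p₁,p₂) : p ∈ orPairs}`. [folklore] -/
theorem image_mk_orPairs (hlower : ∀ x y, G.Adj x y → (lower x y ↔ ¬ lower y x)) :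
    (orPairs G Λ lower).image (fun p => s((p.1 : V), p.2)) = edgesIn G Λ := by
  ext e
  rw [Finset.mem_image, mem_edgesIn_iff]
  constructor
  · rintro ⟨p, hp, rfl⟩
    rw [mem_orPairs] at hp
    refine ⟨(SimpleGraph.mem_edgeSet G).2 hp.1, fun x hx => ?_⟩
    rcases Sym2.mem_iff.1 hx with rfl | rfl
    · exact p.1.2
    · exact p.2.2
  · rintro ⟨he, hmem⟩
    induction e using Sym2.ind with
    | _ a b =>
      have hadj : G.Adj a b := by simpa using he
      have ha : a ∈ Λ := hmem a (Sym2.mem_mk_left a b)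
      have hb : b ∈ Λ := hmem b (Sym2.mem_mk_right a b)
      by_cases hl : lower a b
      · exact ⟨(⟨a, ha⟩, ⟨b, hb⟩), (mem_orPairs G Λ lower).2 ⟨hadj, hl⟩, rfl⟩
      · refine ⟨(⟨b, hb⟩, ⟨a, ha⟩), (mem_orPairs G Λ lower).2 ⟨hadj.symm, ?_⟩, Sym2.eq_swap⟩
        show lower b a
        by_contra hl'
        exact hl ((hlower a b hadj).2 hl')

/-- Products over `ℰ_Λ` are products over the oriented pairs. [folklore] -/
theorem prod_edgesIn_eq_prod_orPairs {M : Type*} [CommMonoid M]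
    (hlower : ∀ x y, G.Adj x y → (lower x y ↔ ¬ lower y x)) (f : Sym2 V → M) :
    ∏ e ∈ edgesIn G Λ, f e = ∏ p ∈ orPairs G Λ lower, f s((p.1 : V), p.2) := by
  rw [← image_mk_orPairs G Λ lower hlower, Finset.prod_image (injOn_mk_orPairs G Λ lower hlower)]

/-- Sums over `ℰ_Λ` are sums over the oriented pairs. [folklore] -/
theorem sum_edgesIn_eq_sum_orPairs {M : Type*} [AddCommMonoid M]
    (hlower : ∀ x y, G.Adj x y → (lower x y ↔ ¬ lower y x)) (f : Sym2 V → M) :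
    ∑ e ∈ edgesIn G Λ, f e = ∑ p ∈ orPairs G Λ lower, f s((p.1 : V), p.2) := by
  rw [← image_mk_orPairs G Λ lower hlower, Finset.sum_image (injOn_mk_orPairs G Λ lower hlower)]

/-! ### The Lee–Yang form of the `+` weights -/

omit [DecidableEq V] [G.LocallyFinite] in
/-- **The real edge weight** `∏_{oriented pairs} [σ agrees ? 1 : t]`. [cite: FriedliVelenik2017, §3.7.4] -/
def edgeWeightR (t : ℝ) (σ : Λ → Bool) : ℝ :=
  ∏ p ∈ orPairs G Λ lower, (if σ p.1 = σ p.2 then 1 else t)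

omit [DecidableEq V] [G.LocallyFinite] in
/-- `edgeWeightR > 0` for `t > 0`. [folklore] -/
theorem edgeWeightR_pos {t : ℝ} (ht : 0 < t) (σ : Λ → Bool) : 0 < edgeWeightR G Λ lower t σ :=
  Finset.prod_pos fun p _ => by split_ifs <;> [exact one_pos; exact ht]

/-- **The base activity** of a site of `Λ` in the field `h` with `+` boundary condition:
`e^{-2β(h_k + #{z ∼ k : z ∉ Λ})}` (the boundary bonds to the frozen `+` spins are fields,
Friedli–Velenik 2017, §3.8.1 p. 141). [cite: FriedliVelenik2017, §3.8.1, p. 141] -/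
def baseAct (β : ℝ) (h : V → ℝ) (k : Λ) : ℝ :=
  Real.exp (-2 * β * (h k + bdryField G Λ 1 k))

omit [DecidableRel G.Adj] in
/-- `baseAct > 0`. [folklore] -/
theorem baseAct_pos (β : ℝ) (h : V → ℝ) (k : Λ) : 0 < baseAct G Λ β h k := Real.exp_pos _

omit [DecidableRel G.Adj] in
/-- `bdryField G Λ 1 k = #{z ∼ k : z ∉ Λ}`. [cite: FriedliVelenik2017, §3.8.1, p. 141] -/
theorem bdryField_one (k : V) : bdryField G Λ 1 k = (outNbrs G Λ k).card := by
  unfold bdryField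
  simp [spinAt]

omit [DecidableRel G.Adj] in
/-- `-ℋ⁺_{Λ;h}` regrouped: bonds inside `Λ` plus the sites with the effective fields
`h_x + #{z ∼ x : z ∉ Λ}`. [cite: FriedliVelenik2017, §3.1 eq. (3.6) and §3.8.1 p. 141] -/
theorem neg_fieldHamiltonian_plusCfg (h : V → ℝ) (σ : Λ → Bool) :
    -fieldHamiltonian G Λ h .plus (plusCfg Λ σ) =
      ∑ e ∈ edgesIn G Λ, bondSpin (plusCfg Λ σ) e +
        ∑ k : Λ, (h k + bdryField G Λ 1 k) * spinAt (k : V) (plusCfg Λ σ) := by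
  have hB : ∑ e ∈ edgeBoundary G Λ, bondSpin (plusCfg Λ σ) e =
      ∑ y ∈ Λ, bdryField G Λ 1 y * spinAt y (plusCfg Λ σ) := by
    rw [sum_edgeBoundary_bondSpin]
    refine Finset.sum_congr rfl fun y _ => ?_
    rw [mul_comm]
    unfold bdryField
    congr 1
    refine Finset.sum_congr rfl fun z hz => ?_
    rw [mem_outNbrs] at hz
    rw [spinAt_plusCfg_of_not_mem Λ σ hz.2]
    simp [spinAt]
  unfold fieldHamiltonian
  rw [show interactionEdges G Λ BoundaryCondition.plus = edgesTouching G Λ from rfl,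
    ← Finset.sum_sdiff (edgesIn_subset_edgesTouching (G := G) Λ),
    show edgesTouching G Λ \ edgesIn G Λ = edgeBoundary G Λ from rfl, hB,
    Finset.sum_coe_sort Λ (fun x => (h x + bdryField G Λ 1 x) * spinAt x (plusCfg Λ σ))]
  simp only [add_mul, Finset.sum_add_distrib]
  ring

omit [DecidableEq V] [G.LocallyFinite] [DecidableRel G.Adj] in
/-- The edge factor: for `a, b ∈ Λ`, `exp(β σ_aσ_b) = e^β [σ_a = σ_b ? 1 : e^{-2β}]`.
[cite: FriedliVelenik2017, §3.7.4 (proof of Thm 3.43, first display)] -/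
theorem exp_mul_bondSpin_plusCfg (β : ℝ) (σ : Λ → Bool) (a b : Λ) :
    Real.exp (β * bondSpin (plusCfg Λ σ) s((a : V), b)) =
      Real.exp β * (if σ a = σ b then 1 else Real.exp (-2 * β)) := by
  rw [bondSpin_mk, spinAt_plusCfg, spinAt_plusCfg]
  cases σ a <;> cases σ b <;> simp [← Real.exp_add]
  all_goals ring_nf

omit [DecidableEq V] [G.LocallyFinite] [DecidableRel G.Adj] in
/-- The site factor: `exp(β g [σ_k ? 1 : -1]) = e^{βg} [σ_k ? 1 : e^{-2βg}]`.
[cite: FriedliVelenik2017, §3.7.4 (proof of Thm 3.43, first display)] -/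
theorem exp_mul_spinAt_plusCfg (β g : ℝ) (σ : Λ → Bool) (k : Λ) :
    Real.exp (β * (g * spinAt (k : V) (plusCfg Λ σ))) =
      Real.exp (β * g) * (if σ k then 1 else Real.exp (-2 * β * g)) := by
  rw [spinAt_plusCfg]
  cases σ k <;> simp [← Real.exp_add]
  all_goals ring_nf

/-- **The `+` weights in Lee–Yang form with a common extra activity.** For the field `h + l`
(constant shift `l` on `Λ`), `t = e^{-2β}`, `ω = e^{-2βl}`:
`w⁺_{Λ;h+l}(τ) = e^{β(|orPairs| + ∑_k (h_k + l + #∂k))} · edgeWeightR t σ · ∏_k [σ_k ? 1 : baseAct_k ω]`,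
`σ` the Boolean code of `τ`. [cite: LeeYang1952, Appendix II] -/
theorem fieldWeight_plus_shift_eq (hlower : ∀ x y, G.Adj x y → (lower x y ↔ ¬ lower y x))
    (β : ℝ) (h : V → ℝ) (l : ℝ) (τ : Λ → ℤˣ) :
    fieldWeight G Λ β (fun x => h x + l) .plus τ =
      Real.exp (β * ((orPairs G Λ lower).card + ∑ k : Λ, (h k + l + bdryField G Λ 1 k))) *
        (edgeWeightR G Λ lower (Real.exp (-2 * β)) (boolOf Λ τ) *
          ∏ k : Λ, (if boolOf Λ τ k then 1 else
            baseAct G Λ β h k * Real.exp (-2 * β * l))) := by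
  set σ := boolOf Λ τ with hσ
  have hH : -β * fieldHamiltonian G Λ (fun x => h x + l) .plus (plusCfg Λ σ) =
      (∑ p ∈ orPairs G Λ lower, β * bondSpin (plusCfg Λ σ) s((p.1 : V), p.2)) +
        ∑ k : Λ, β * ((h k + l + bdryField G Λ 1 k) * spinAt (k : V) (plusCfg Λ σ)) := by
    have e := neg_fieldHamiltonian_plusCfg G Λ (fun x => h x + l) σ
    rw [sum_edgesIn_eq_sum_orPairs G Λ lower hlower] at e
    rw [show -β * fieldHamiltonian G Λ (fun x => h x + l) .plus (plusCfg Λ σ) =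
        β * (-fieldHamiltonian G Λ (fun x => h x + l) .plus (plusCfg Λ σ)) by ring, e, mul_add,
      Finset.mul_sum, Finset.mul_sum]
  have hsite : ∀ k : Λ, Real.exp (β * ((h k + l + bdryField G Λ 1 k) * spinAt (k : V) (plusCfg Λ σ))) =
      Real.exp (β * (h k + l + bdryField G Λ 1 k)) *
        (if σ k then 1 else baseAct G Λ β h k * Real.exp (-2 * β * l)) := by
    intro k
    rw [exp_mul_spinAt_plusCfg]
    congr 1
    split_ifs
    · rfl
    · rw [baseAct, ← Real.exp_add]
      congr 1
      ring
  unfold fieldWeight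
  rw [glue_plus_eq_plusCfg, ← hσ, hH, Real.exp_add, Real.exp_sum, Real.exp_sum]
  simp_rw [exp_mul_bondSpin_plusCfg, hsite]
  rw [Finset.prod_mul_distrib, Finset.prod_const, Finset.prod_mul_distrib, ← Real.exp_sum,
    edgeWeightR]
  have hexp : Real.exp β ^ (orPairs G Λ lower).card *
      Real.exp (∑ k : Λ, β * (h k + l + bdryField G Λ 1 k)) =
      Real.exp (β * ((orPairs G Λ lower).card + ∑ k : Λ, (h k + l + bdryField G Λ 1 k))) := by
    rw [← Real.exp_nat_mul, ← Real.exp_add, ← Finset.mul_sum]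
    congr 1
    ring
  rw [← hexp]
  ring

omit [DecidableEq V] [G.LocallyFinite] in
/-- Cancelling a common factor in a Gibbs ratio after reindexing by an equivalence. [folklore] -/
theorem sum_div_sum_eq_of_equiv {α γ : Type*} [Fintype α] [Fintype γ] (e : α ≃ γ) {K : ℝ}
    (hK : 0 < K) (W : γ → ℝ) (hW : 0 < ∑ b, W b) (n : γ → ℝ) (c : ℝ) :
    (∑ a, K * W (e a) * (c - 2 * n (e a))) / (∑ a, K * W (e a)) =
      c - 2 * ((∑ b, n b * W b) / ∑ b, W b) := by
  rw [Fintype.sum_equiv e (fun a => K * W (e a) * (c - 2 * n (e a)))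
      (fun b => K * W b * (c - 2 * n b)) fun _ => rfl,
    Fintype.sum_equiv e (fun a => K * W (e a)) (fun b => K * W b) fun _ => rfl]
  have h1 : ∑ b, K * W b * (c - 2 * n b) = K * (c * ∑ b, W b - 2 * ∑ b, n b * W b) := by
    rw [Finset.mul_sum, Finset.mul_sum, ← Finset.sum_sub_distrib, Finset.mul_sum]
    exact Finset.sum_congr rfl fun b _ => by ring
  rw [h1, ← Finset.mul_sum]
  field_simp

/-- **`∑_{k∈Λ} ⟨σ_k⟩⁺_{Λ;h+l} = |Λ| - 2 ⟨#minus⟩_ω`**, `ω = e^{-2βl}`, the mean number of minus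
spins of the Lee–Yang weight (`LeeYangRadii.minusMean`): the prefactor of
`fieldWeight_plus_shift_eq` cancels in the Gibbs ratio. [cite: LeeYang1952, §V] -/
theorem sum_fieldExpect_plus_shift_eq (hlower : ∀ x y, G.Adj x y → (lower x y ↔ ¬ lower y x))
    (β : ℝ) (h : V → ℝ) (l : ℝ) :
    ∑ k ∈ Λ, fieldExpect G Λ β (fun x => h x + l) .plus (spinAt k) =
      Λ.card - 2 * LeeYangRadii.minusMean (edgeWeightR G Λ lower (Real.exp (-2 * β)))
        (baseAct G Λ β h) (Real.exp (-2 * β * l)) := by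
  classical
  rw [← fieldExpect_finset_sum G Λ β _ .plus Λ spinAt fun k => measurable_spinAt k,
    fieldExpect_eq_sum_div G Λ β _ .plus (Finset.measurable_sum Λ fun k _ => measurable_spinAt k)]
  simp_rw [sum_spinAt_glue_plus]
  rw [fieldZ]
  simp_rw [fieldWeight_plus_shift_eq G Λ lower hlower β h l]
  have hWpos : 0 < ∑ σ : Λ → Bool, edgeWeightR G Λ lower (Real.exp (-2 * β)) σ *
      ∏ k : Λ, (if σ k then (1 : ℝ) else baseAct G Λ β h k * Real.exp (-2 * β * l)) :=
    Finset.sum_pos (fun σ _ => mul_pos (edgeWeightR_pos G Λ lower (Real.exp_pos _) σ)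
      (Finset.prod_pos fun k _ => by
        split_ifs <;> [exact one_pos; exact mul_pos (baseAct_pos G Λ β h k) (Real.exp_pos _)]))
      Finset.univ_nonempty
  exact sum_div_sum_eq_of_equiv (boolEquiv Λ) (Real.exp_pos _)
    (fun σ => edgeWeightR G Λ lower (Real.exp (-2 * β)) σ *
      ∏ k : Λ, (if σ k then (1 : ℝ) else baseAct G Λ β h k * Real.exp (-2 * β * l)))
    hWpos (fun σ => (LeeYangRadii.minusCount σ : ℝ)) _

/-! ### Zero-freeness from certified radii, and the Lipschitz bound -/

variable (rad : V → ℝ)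

omit [G.LocallyFinite] in
/-- The oriented edges with the radius parameter of their lower end, as triples for
`LeeYangRadii.radii`. [cite: LeeYang1952, Appendix II] -/
def orTriples : Finset (Λ × Λ × ℝ) :=
  (orPairs G Λ lower).image fun p => (p.1, p.2, rad p.1)

omit [G.LocallyFinite] in
/-- The real edge weight is the Lee–Yang edge weight of the oriented triples. [folklore] -/
theorem edgeWeightR_eq_edgeWeight (t : ℝ) (σ : Λ → Bool) :
    (edgeWeightR G Λ lower t σ : ℂ) = LeeYangRadii.edgeWeight t (orTriples G Λ lower rad) σ := by
  unfold edgeWeightR LeeYangRadii.edgeWeight orTriples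
  rw [Finset.prod_image fun p _ q _ hpq => by
    simp only [Prod.mk.injEq] at hpq
    exact Prod.ext hpq.1 hpq.2.1]
  push_cast
  refine Finset.prod_congr rfl fun p _ => ?_
  split_ifs <;> simp

/-- **Zero-freeness of the `+` Lee–Yang sum from certified radii**: for `β ≥ 0`, radii
`0 < rad ≤ 1`, and `ω` with `baseAct_k · ‖ω‖ < radii t (orTriples) k` for every `k ∈ Λ`, the
Lee–Yang sum `∑_σ edgeWeightR σ ∏_k [σ_k ? 1 : baseAct_k ω]` does not vanish
(`LeeYangRadii.zeroFree_prod_edges`). [cite: LeeYang1952, Appendix II] -/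
theorem lySum_plus_ne_zero {β : ℝ} (hβ : 0 ≤ β) (hrad : ∀ x, 0 < rad x ∧ rad x ≤ 1) (h : V → ℝ)
    {ω : ℂ} (hω : ∀ k : Λ, baseAct G Λ β h k * ‖ω‖ <
      LeeYangRadii.radii (Real.exp (-2 * β)) (orTriples G Λ lower rad) k) :
    LeeYangRadii.lySum (edgeWeightR G Λ lower (Real.exp (-2 * β))) (baseAct G Λ β h) ω ≠ 0 := by
  have ht0 : 0 ≤ Real.exp (-2 * β) := (Real.exp_pos _).le
  have ht1 : Real.exp (-2 * β) ≤ 1 := by rw [Real.exp_le_one_iff]; nlinarith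
  have hE : ∀ e ∈ orTriples G Λ lower rad, e.1 ≠ e.2.1 ∧ 0 < e.2.2 ∧ e.2.2 ≤ 1 := by
    intro e he
    obtain ⟨p, hp, rfl⟩ := Finset.mem_image.1 he
    rw [mem_orPairs] at hp
    refine ⟨fun heq => G.ne_of_adj hp.1 (by rw [heq]), (hrad _).1, (hrad _).2⟩
  have key := LeeYangRadii.zeroFree_prod_edges ht0 ht1 (orTriples G Λ lower rad) hE
    (fun k => (baseAct G Λ β h k : ℂ) * ω) fun k => by
      rw [norm_mul, Complex.norm_real, Real.norm_eq_abs, abs_of_pos (baseAct_pos G Λ β h k)]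
      exact hω k
  unfold LeeYangRadii.lySum
  simp_rw [edgeWeightR_eq_edgeWeight G Λ lower rad]
  exact key

/-- **The Lipschitz bound on the `+` magnetisation sum from a zero-free disc.** If the `+`
Lee–Yang sum of `(Λ, h)` has no zero for `‖ω‖ < R` with `R > 1`, then for `β > 0`, `δ` with
`e^{2βδ} ≤ (1+R)/2` and every `-δ ≤ l ≤ 0`:
`∑_{k∈Λ} ⟨σ_k⟩⁺_{Λ;β,h} - ∑_{k∈Λ} ⟨σ_k⟩⁺_{Λ;β,h+l} ≤ |Λ| · 8βR e^{2βδ}/(R-1)² · (-l)`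
(`sum_fieldExpect_plus_shift_eq` at `l` and `0`, `LeeYangRadii.abs_minusMean_sub_le`, and
`e^{-2βl} - 1 ≤ 2β(-l) e^{-2βl} ≤ 2β(-l) e^{2βδ}`). [cite: LeeYang1952, §V] -/
theorem sum_fieldExpect_plus_sub_shift_le (hlower : ∀ x y, G.Adj x y → (lower x y ↔ ¬ lower y x))
    {β : ℝ} (hβ : 0 < β) (h : V → ℝ) {R : ℝ} (hR : 1 < R)
    (hZ : ∀ ω : ℂ, ‖ω‖ < R →
      LeeYangRadii.lySum (edgeWeightR G Λ lower (Real.exp (-2 * β))) (baseAct G Λ β h) ω ≠ 0)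
    {δ : ℝ} (hδR : Real.exp (2 * β * δ) ≤ (1 + R) / 2) {l : ℝ} (hl1 : -δ ≤ l) (hl2 : l ≤ 0) :
    ∑ k ∈ Λ, fieldExpect G Λ β h .plus (spinAt k) -
        ∑ k ∈ Λ, fieldExpect G Λ β (fun x => h x + l) .plus (spinAt k) ≤
      Λ.card * (8 * β * R * Real.exp (2 * β * δ) / (R - 1) ^ 2) * (-l) := by
  set w := edgeWeightR G Λ lower (Real.exp (-2 * β)) with hw
  set b := baseAct G Λ β h with hb
  set ω : ℝ := Real.exp (-2 * β * l) with hω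
  have h0 : ∑ k ∈ Λ, fieldExpect G Λ β h .plus (spinAt k) =
      Λ.card - 2 * LeeYangRadii.minusMean w b 1 := by
    have := sum_fieldExpect_plus_shift_eq G Λ lower hlower β h 0
    simp only [add_zero, mul_zero, Real.exp_zero] at this
    exact this
  rw [h0, sum_fieldExpect_plus_shift_eq G Λ lower hlower β h l, ← hw, ← hb, ← hω]
  -- `ω ∈ [1, e^{2βδ}]`
  have hω1 : 1 ≤ ω := by rw [hω]; exact Real.one_le_exp (by nlinarith)
  have hωδ : ω ≤ Real.exp (2 * β * δ) := by rw [hω, Real.exp_le_exp]; nlinarith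
  have hωabs : |ω| ≤ (1 + R) / 2 := by rw [abs_of_pos (Real.exp_pos _)]; linarith
  have hLip := LeeYangRadii.abs_minusMean_sub_le w b hR hZ hωabs
  -- `|ω - 1| ≤ 2β(-l) e^{2βδ}`
  have hω_sub : |ω - 1| ≤ 2 * β * (-l) * Real.exp (2 * β * δ) := by
    rw [abs_of_nonneg (by linarith)]
    -- `e^x - 1 ≤ x e^x` (from `1 - x ≤ e^{-x}`) at `x = -2βl`
    have h1 : ω - 1 ≤ -2 * β * l * ω := by
      have h := Real.add_one_le_exp (-(-2 * β * l))
      have hpos := Real.exp_pos (-2 * β * l)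
      have : Real.exp (-2 * β * l) * Real.exp (-(-2 * β * l)) = 1 := by
        rw [← Real.exp_add, add_neg_cancel, Real.exp_zero]
      rw [hω]
      nlinarith [mul_le_mul_of_nonneg_left h hpos.le]
    calc ω - 1 ≤ -2 * β * l * ω := h1
      _ = 2 * β * (-l) * ω := by ring
      _ ≤ 2 * β * (-l) * Real.exp (2 * β * δ) :=
          mul_le_mul_of_nonneg_left hωδ (by nlinarith)
  have hK : 0 ≤ (Fintype.card Λ : ℝ) * (2 * R / (R - 1) ^ 2) := by positivity
  have hcard : (Fintype.card Λ : ℝ) = Λ.card := by rw [Fintype.card_coe]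
  have hmul := mul_le_mul_of_nonneg_left hω_sub hK
  calc (Λ.card : ℝ) - 2 * LeeYangRadii.minusMean w b 1 -
        (Λ.card - 2 * LeeYangRadii.minusMean w b ω)
      = 2 * (LeeYangRadii.minusMean w b ω - LeeYangRadii.minusMean w b 1) := by ring
    _ ≤ 2 * |LeeYangRadii.minusMean w b ω - LeeYangRadii.minusMean w b 1| := by
        linarith [le_abs_self (LeeYangRadii.minusMean w b ω - LeeYangRadii.minusMean w b 1)]
    _ ≤ 2 * ((Fintype.card Λ : ℝ) * (2 * R / (R - 1) ^ 2) * |ω - 1|) := by linarith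
    _ ≤ 2 * ((Fintype.card Λ : ℝ) * (2 * R / (R - 1) ^ 2) *
          (2 * β * (-l) * Real.exp (2 * β * δ))) := by linarith
    _ = Λ.card * (8 * β * R * Real.exp (2 * β * δ) / (R - 1) ^ 2) * (-l) := by
        rw [hcard]; ring

end Literature.Probability.LatticeModels

end
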